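import Summits.BirchSwinnertonDyer.Rank1Residual.GaloisImage.KolyvaginSystemOfEulerSystemPair
import Summits.BirchSwinnertonDyer.Rank1Residual.GaloisImage.KolyvaginSystemOfEulerSystemBadPlaces
import HarnessLib

/-!
# THEOREM D at TWO depths with (COMP) on the rows WITH ANOMALOUS bad places: one Euler system of
# `T_pE/ℚ`, ONE generator family, the two Kolyvagin systems in `KS(E[p^k·p], 𝓕_can, 𝒫″)` and
# `KS(E[p^m·p], 𝓕_can, 𝒫″)` compatible under `x ↦ p^{m−k}x` — n1011-p11's D7 with `hbad` replaced by
# the cube-order clause `hP″` of n1011-p15's T-DER-D4BN F2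
# (cell `b2b-bsdres`, team n1011; row END-b, TOOL file D7-b; seat p13 GEN 15; lead R5-119 ADD 1;
# r1 GEN 48 (C) option (a) 'thinner 𝒫', GEN 49 (d1): END-b typed on the thinned data only)

HONEST FRAMING (cell `b2b-bsdres`, run/shared/lean/b2b/bsd-rank1-residual/, verbatim in every
file): the goal of the cell is to DELETE the COMBINATION-SHAPED residual classes of the
Birch–Swinnerton-Dyer formula for ALL analytic-rank `≤ 1` elliptic curves over `ℚ` — "full BSD
formula for every rank `≤ 1` curve in class `C`" assembled STRICTLY from published theorems — so
that the rank-`≤ 1` remainder becomes exactly the CONSTRUCTION-SHAPED classes, which are TYPED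
(missing-input `Prop`s), NOT attempted. This is not "finishing BSD". Team n1011 (N10/N11; route-1
PORT, (P-DER) clauses C0/C1/(COMP)): research route on the CONSTRUCTION-SHAPED class X4 / §I N11;
TOOL theorem; nothing booked; no mark / label / count moved. No definition, no named fact, no `sorry`.

## What

n1011-p11's D7 `Derivative.Rat.exists_isKolyvaginSystem_pair_propagatedSelmerStructure` (ONE Euler
system `c` of `T_pE` — hypothesis `hc`, the PORT binds Kato's `ZetaBody … |>.1` — TWO depths `k ≤ m`,
ONE generator family `σ` for both data, the Kolyvagin systems for Mazur–Rubin's `𝓕_can` at both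
depths and the reduction compatibility (COMP) `π_* κ″_d = κ_d`) serves the rows with `E(ℚ_w)[p] = 0`
at EVERY bad `w ≠ p` (`hbad`).  **`exists_isKolyvaginSystem_pair_propagatedSelmerStructure_of_primes''`**
is the same theorem with `hbad` REPLACED by the prime-thinning clauses of n1011-p15's single-depth END
`exists_isKolyvaginSystem_propagatedSelmerStructure_of_primes''`, one per datum:

* `hP''  : ∀ q ∈ 𝒫(D),  ∀` ANOMALOUS bad `w ≠ p` (a non-zero `p`-torsion point over `ℚ_w`),
  `p ∤ orderOf (w : ZMod q)`;
* `hP''₂ : ∀ q ∈ 𝒫(D″), ` the same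

— i.e. both data have their primes in the set `𝒫″` of ROUTE-1 §43.5 (a)/§45.4 (r1 GEN 48 (C):
`D.primes ⊆ class ∩ C_B`, `B` = the anomalous bad places of `E`, which is NOT a binder: the clause
names them).  On a row without anomalous bad places both clauses are vacuous, so D7 is the special
case.  Every other binder and the whole conclusion are D7's, token for token (the pins `hcomp`,
`hcomp″` in D7's `proj` form).  Proof = D7's (D1 `exists_sigma_mem_inertia_adicCompletionPrime` on
`𝒫(D) ∪ 𝒫(D″)`; `h0` from `Irr(E[p])`; D2 `exists_derivativeFamily` ×2 with the SAME `σ`; D3b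
`isKolyvaginSystem_derivativeFamily_of_transverse_eq` ×2; (COMP) by D7's `map_derivativeFamily_eq`) with
D3b's displayed local clause at a place `w ∉ d` that is not (good ∧ `≠ p`) discharged, at EACH depth,
by n1011-p15's three-way split: `w ∣ p` → `htop`/`htop″`; bad `w` with `E(ℚ_w)[p] = 0` → D4's
`propagatedSelmerStructure_inr_eq_top_of_torsion_eq_zero` (F10); ANOMALOUS bad `w` → T-DER-D4BN F1 ★
`Rat.localization_mem_propagatedSelmerStructure_of_res_eq_deriv_of_forall_not_dvd_orderOf`
(T-DER-BN ∘ GZ-4) on the pulled-back class `Φ₀⁻¹(κ_d)` (GZ-1 `exists_addEquiv_oneCocycleClass`,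
C5b-β′ `CoeffTransport.resSubgroup_symm_eq_noncommProd_deriv`), `hP″`/`hP″₂` supplying
`p ∤ ord(w mod q)` for every `q ∈ d`.

HONEST LIMITS: no Euler system asserted; the place `p` stays the displayed `htop`/`htop″` (`t = 0`
rows: F11/F12 along the reduction tower); no certificate that a given prime lies in `𝒫″` (records;
the thinned prime CHOICE is n1011-p11's T-PC-THIN, consumer side); values C2/C3 not here; closes
nothing by itself.  Consumer of record: END-b F2 `GaloisImage/KatoKuriharaPortThreeOfZetaBodyBad`
(★ PK-6₂'s END-b twin, this seat).

References: B. Mazur, K. Rubin, Mem. AMS 799 (2004), Def. 3.2.1, Thm. 3.2.4, App. A; K. Rubin,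
*Euler Systems* (2000) Def. 4.4.4, Lemma 4.4.2, Thm. 4.5.1, 4.5.4; K. Rubin, PCMI 18 (2011) §3.1;
C.-H. Kim, arXiv:2203.12159, Thm. 3.13, §2.2.2; design `cells/n1011/ROUTE-1.md` §43.5 (a), §45.4,
§60.5 (C), §61.3 (d1); `cells/n1011/skel/T-DER-D4BN.md`, `skel/T-ENDB-F2.md`.
-/

noncomputable section

open CategoryTheory Function Finset Polynomial Field IsDedekindDomain
open scoped NumberField Classical ContRepresentation
open Literature.NumberTheory.GaloisRepresentations Literature.NumberTheory.EllipticCurves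
open Literature.NumberTheory.GaloisRepresentations.DiscreteGaloisModule
open Literature.NumberTheory.GaloisCohomology
open Summit.BirchSwinnertonDyer.Rank1Residual.GaloisImage.CoeffTransport
open Summit.BirchSwinnertonDyer.Rank1Residual.GaloisImage.CyclotomicLevel
open Rat.HeightOneSpectrum WeierstrassCurve TateModule

universe u

namespace Summit.BirchSwinnertonDyer.Rank1Residual.GaloisImage.Derivative.Rat

variable (W : WeierstrassCurve ℚ) [W.IsElliptic] [W.IsGloballyMinimal] (p : ℕ) [Fact p.Prime]
variable [Module.Free ℤ_[p] (W.tateModule p)] [Module.Finite ℤ_[p] (W.tateModule p)]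
  [ContinuousSMul ℤ_[p] (W.tateModule p)]

/-- Local notation: `T∞ = T_p E` as a continuous `G_ℚ`-representation. -/
local notation3 "T∞" => WeierstrassCurve.tateGaloisRep W p (W.continuous_galoisRepTate_holds p)

/-- Local notation: `𝐫⟦f, T′, U⟧ = f_* : H¹(U, T_pE) → H¹(U, T′)`. -/
local notation3 (prettyPrint := false) "𝐫⟦" f ", " Tg ", " U "⟧" =>
  ContinuousCohomology.map (ContinuousMonoidHom.id _)
    (X := subgroupRep (ContinuousRep.toTopRep T∞) U)
    (Y := subgroupRep (ContinuousRep.toTopRep Tg) U)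
    ((TopRep.resFunctor (Subgroup.subtype U)).map f) 1

variable (S : Set (HeightOneSpectrum (𝓞 ℚ)))

/-- Local notation: `𝓛` = the cyclotomic Euler-system levels `ℚ(μ_{p^{n+1}}, μ_r)`, `r ∩ S = ∅`. -/
local notation3 "𝓛" => cyclotomicLevelsRat p S

/-- Local notation: `𝐃⟦A, X, U, τ⟧ ℓ = ∑_{j < ℓ−1} j·(τ_ℓ)_*^j`, Kolyvagin's derivative operator. -/
local notation3 (prettyPrint := false) "𝐃⟦" A ", " X ", " U ", " τ "⟧" =>
  fun ℓ : HeightOneSpectrum (𝓞 ℚ) =>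
  ∑ j ∈ Finset.range (((primesEquiv ℓ : Nat.Primes) : ℕ) - 1),
    (j : Module.End A (continuousCohomology 1 (subgroupRep X U))) *
      (conjMap X U ((τ : HeightOneSpectrum (𝓞 ℚ) → absoluteGaloisGroup ℚ) ℓ) 1).hom.toLinearMap ^ j

/-- **THEOREM D at TWO depths with (COMP) on `𝒫″`-data** (rows WITH anomalous bad places allowed):
every binder of n1011-p11's D7 `exists_isKolyvaginSystem_pair_propagatedSelmerStructure` with `hbad`
replaced by `hP''` / `hP''₂` (`p ∤ ord(w mod q)` for every `q ∈ 𝒫(D)` resp. `𝒫(D″)` and every bad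
`w ≠ p` carrying a non-zero `p`-torsion point over `ℚ_w`); `htop`, `htop″` at `p` unchanged.
Conclusion identical to D7's: ONE `σ`, transports `Φ_r`, `Φ″_r`, the two families with
`D.IsKolyvaginSystem (𝓕_can,k) κ`, `D″.IsKolyvaginSystem (𝓕_can,m) κ″`, the derivative
characterisations, and `π_* (κ″ d) = κ d` on the common levels.
[cite: MazurRubin2004, Def. 3.2.1, Thm. 3.2.4 and App. A] [cite: Rubin2000, Def. 4.4.4, Lemma 4.4.2, Thm. 4.5.1]
[cite: Rubin2011, §3.1 (p. 29)] [cite: Kim2022StructureSelmer, Thm. 3.13 and §2.2.2] -/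
theorem exists_isKolyvaginSystem_pair_propagatedSelmerStructure_of_primes'' (hp2 : p ≠ 2) {k m : ℕ}
    (hkm : k ≤ m)
    {c : ∀ (i : ℕ) (r : (𝓛).Ideals), H1 T∞ ((𝓛).level i r.1)}
    (hc : IsEulerSystem 𝓛 T∞ p c)
    -- depth `k`
    {M' : Type} [AddCommGroup M'] [Module ℤ_[p] M'] [TopologicalSpace M'] [DiscreteTopology M']
    [IsTopologicalAddGroup M'] [ContinuousSMul ℤ_[p] M'] {T' : GaloisRep ℚ ℤ_[p] M'}
    (red : T∞.toTopRep ⟶ T'.toTopRep) (hred : Function.Surjective red.hom)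
    (hM : ∀ x : M', ((p : ℤ_[p]) ^ (k + 1)) • x = 0)
    (e : M' →+ WeierstrassCurve.geomTorsion W ((p : ℤ) ^ k * (p : ℤ))) (hec : Continuous e)
    (he : ∀ (g : absoluteGaloisGroup ℚ) (x : M'),
      e (T'.toTopRep.ρ g x) = (W.torsionGaloisModule ((p : ℤ) ^ k * (p : ℤ))).toTopRep.ρ g (e x))
    (einv : WeierstrassCurve.geomTorsion W ((p : ℤ) ^ k * (p : ℤ)) →+ M') (hic : Continuous einv)
    (h₁ : ∀ x, einv (e x) = x) (h₂ : ∀ y, e (einv y) = y)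
    (hcomp : ∀ a : W.tateModule p,
      ((e (red.hom a) : geomTorsion W ((p : ℤ) ^ k * (p : ℤ))) : geomPoints W) = proj p (k + 1) a)
    -- depth `m`
    {M'' : Type} [AddCommGroup M''] [Module ℤ_[p] M''] [TopologicalSpace M''] [DiscreteTopology M'']
    [IsTopologicalAddGroup M''] [ContinuousSMul ℤ_[p] M''] {T'' : GaloisRep ℚ ℤ_[p] M''}
    (red'' : T∞.toTopRep ⟶ T''.toTopRep) (hred'' : Function.Surjective red''.hom)
    (hM'' : ∀ x : M'', ((p : ℤ_[p]) ^ (m + 1)) • x = 0)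
    (e'' : M'' →+ WeierstrassCurve.geomTorsion W ((p : ℤ) ^ m * (p : ℤ))) (hec'' : Continuous e'')
    (he'' : ∀ (g : absoluteGaloisGroup ℚ) (x : M''),
      e'' (T''.toTopRep.ρ g x) = (W.torsionGaloisModule ((p : ℤ) ^ m * (p : ℤ))).toTopRep.ρ g (e'' x))
    (einv'' : WeierstrassCurve.geomTorsion W ((p : ℤ) ^ m * (p : ℤ)) →+ M'') (hic'' : Continuous einv'')
    (h₁'' : ∀ x, einv'' (e'' x) = x) (h₂'' : ∀ y, e'' (einv'' y) = y)
    (hcomp'' : ∀ a : W.tateModule p,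
      ((e'' (red''.hom a) : geomTorsion W ((p : ℤ) ^ m * (p : ℤ))) : geomPoints W) = proj p (m + 1) a)
    (π : (W.torsionGaloisModule ((p : ℤ) ^ m * (p : ℤ))).toContRepresentation →ⁱL
      (W.torsionGaloisModule ((p : ℤ) ^ k * (p : ℤ))).toContRepresentation)
    (hπ : ∀ x : geomTorsion W ((p : ℤ) ^ m * (p : ℤ)),
      ((π x : geomTorsion W ((p : ℤ) ^ k * (p : ℤ))) : geomPoints W) =
        ((p : ℤ) ^ (m - k)) • (x : geomPoints W))
    -- the curve and the two datums (same primitive roots `η`)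
    (hirr : W.HasIrreducibleModPGaloisRep p)
    (D : KolyvaginDatum (W.torsionGaloisModule ((p : ℤ) ^ k * (p : ℤ))))
    (hT : D.transverse = cyclotomicTransverse (W.torsionGaloisModule ((p : ℤ) ^ k * (p : ℤ))))
    (D'' : KolyvaginDatum (W.torsionGaloisModule ((p : ℤ) ^ m * (p : ℤ))))
    (hT'' : D''.transverse = cyclotomicTransverse (W.torsionGaloisModule ((p : ℤ) ^ m * (p : ℤ))))
    {η : (ℓ : HeightOneSpectrum (𝓞 ℚ)) → (ZMod (Ideal.absNorm ℓ.asIdeal))ˣ}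
    (hD : D.HasCanonicalComparison (p ^ (k + 1)) η) (hD'' : D''.HasCanonicalComparison (p ^ (m + 1)) η)
    (hPr : D.primes ⊆ (𝓛).primes) (hPr'' : D''.primes ⊆ (𝓛).primes)
    (hKol : ∀ ℓ ∈ D.primes, Kato.IsKolyvaginPrime W p (k + 1) ((primesEquiv ℓ : Nat.Primes) : ℕ))
    (hKol'' : ∀ ℓ ∈ D''.primes, Kato.IsKolyvaginPrime W p (m + 1) ((primesEquiv ℓ : Nat.Primes) : ℕ))
    -- the thinning of the primes at the ANOMALOUS bad places (`𝒫″`), one clause per datum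
    (hP'' : ∀ q ∈ D.primes, ∀ w : HeightOneSpectrum (𝓞 ℚ), ¬ W.HasGoodReductionAt w →
      ((primesEquiv w : Nat.Primes) : ℕ) ≠ p →
      (∃ P : (W.baseChange (w.adicCompletion ℚ)).toAffine.Point, p • P = 0 ∧ P ≠ 0) →
        ¬ p ∣ orderOf ((((primesEquiv w : Nat.Primes) : ℕ) : ZMod ((primesEquiv q : Nat.Primes) : ℕ))))
    (hP''₂ : ∀ q ∈ D''.primes, ∀ w : HeightOneSpectrum (𝓞 ℚ), ¬ W.HasGoodReductionAt w →
      ((primesEquiv w : Nat.Primes) : ℕ) ≠ p →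
      (∃ P : (W.baseChange (w.adicCompletion ℚ)).toAffine.Point, p • P = 0 ∧ P ≠ 0) →
        ¬ p ∣ orderOf ((((primesEquiv w : Nat.Primes) : ℕ) : ZMod ((primesEquiv q : Nat.Primes) : ℕ))))
    (htop : ∀ w : HeightOneSpectrum (𝓞 ℚ), ((primesEquiv w : Nat.Primes) : ℕ) = p →
      propagatedSelmerStructure W p k (Sum.inr w) = ⊤)
    (htop'' : ∀ w : HeightOneSpectrum (𝓞 ℚ), ((primesEquiv w : Nat.Primes) : ℕ) = p →
      propagatedSelmerStructure W p m (Sum.inr w) = ⊤) :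
    ∃ (σ : HeightOneSpectrum (𝓞 ℚ) → absoluteGaloisGroup ℚ)
      (Φ : ∀ r : Finset (HeightOneSpectrum (𝓞 ℚ)),
        continuousCohomology 1 (subgroupRep T'.toTopRep ((𝓛).level ⊥ r)) →+
          continuousCohomology 1 (subgroupRep
            (W.torsionGaloisModule ((p : ℤ) ^ k * (p : ℤ))).toTopRep ((𝓛).level ⊥ r)))
      (comm : ∀ r : Finset (HeightOneSpectrum (𝓞 ℚ)),
        ((r : Finset _) : Set (HeightOneSpectrum (𝓞 ℚ))).Pairwise fun a b =>
          Commute (𝐃⟦ℤ, (W.torsionGaloisModule ((p : ℤ) ^ k * (p : ℤ))).toTopRep, ((𝓛).level ⊥ r), σ⟧ a)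
            (𝐃⟦ℤ, (W.torsionGaloisModule ((p : ℤ) ^ k * (p : ℤ))).toTopRep, ((𝓛).level ⊥ r), σ⟧ b))
      (κ : Finset (HeightOneSpectrum (𝓞 ℚ)) → galoisCohomology (W.torsionGaloisModule ((p : ℤ) ^ k * (p : ℤ))) 1)
      (Φ'' : ∀ r : Finset (HeightOneSpectrum (𝓞 ℚ)),
        continuousCohomology 1 (subgroupRep T''.toTopRep ((𝓛).level ⊥ r)) →+
          continuousCohomology 1 (subgroupRep
            (W.torsionGaloisModule ((p : ℤ) ^ m * (p : ℤ))).toTopRep ((𝓛).level ⊥ r)))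
      (comm'' : ∀ r : Finset (HeightOneSpectrum (𝓞 ℚ)),
        ((r : Finset _) : Set (HeightOneSpectrum (𝓞 ℚ))).Pairwise fun a b =>
          Commute (𝐃⟦ℤ, (W.torsionGaloisModule ((p : ℤ) ^ m * (p : ℤ))).toTopRep, ((𝓛).level ⊥ r), σ⟧ a)
            (𝐃⟦ℤ, (W.torsionGaloisModule ((p : ℤ) ^ m * (p : ℤ))).toTopRep, ((𝓛).level ⊥ r), σ⟧ b))
      (κ'' : Finset (HeightOneSpectrum (𝓞 ℚ)) →
        galoisCohomology (W.torsionGaloisModule ((p : ℤ) ^ m * (p : ℤ))) 1),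
      (∀ ℓ, σ ℓ ∈ (adicCompletionPrime ℚ ℓ).inertia (absoluteGaloisGroup ℚ)) ∧
      (∀ ℓ, modNCyclotomicCharacter ℚ (Ideal.absNorm ℓ.asIdeal) (σ ℓ) = η ℓ) ∧
      (∀ r, ∀ (φ : contOneCocycles (subgroupRep T'.toTopRep ((𝓛).level ⊥ r)))
        (ψ : contOneCocycles (subgroupRep
          (W.torsionGaloisModule ((p : ℤ) ^ k * (p : ℤ))).toTopRep ((𝓛).level ⊥ r))),
        (∀ g, ψ.1 g = e (φ.1 g)) → Φ r (oneCocycleClass _ φ) = oneCocycleClass _ ψ) ∧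
      (∀ r, ∀ (φ : contOneCocycles (subgroupRep T''.toTopRep ((𝓛).level ⊥ r)))
        (ψ : contOneCocycles (subgroupRep
          (W.torsionGaloisModule ((p : ℤ) ^ m * (p : ℤ))).toTopRep ((𝓛).level ⊥ r))),
        (∀ g, ψ.1 g = e'' (φ.1 g)) → Φ'' r (oneCocycleClass _ φ) = oneCocycleClass _ ψ) ∧
      D.IsKolyvaginSystem (propagatedSelmerStructure W p k) κ ∧
      D''.IsKolyvaginSystem (propagatedSelmerStructure W p m) κ'' ∧
      (∀ r : Finset (HeightOneSpectrum (𝓞 ℚ)), ¬ (↑r : Set _) ⊆ D.primes → κ r = 0) ∧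
      (∀ r : Finset (HeightOneSpectrum (𝓞 ℚ)), ¬ (↑r : Set _) ⊆ D''.primes → κ'' r = 0) ∧
      (∀ (r : Finset (HeightOneSpectrum (𝓞 ℚ))) (hr : (↑r : Set _) ⊆ D.primes),
        resSubgroup (W.torsionGaloisModule ((p : ℤ) ^ k * (p : ℤ))).toTopRep ((𝓛).level ⊥ r) 1 (κ r) =
          (r.noncommProd 𝐃⟦ℤ, (W.torsionGaloisModule ((p : ℤ) ^ k * (p : ℤ))).toTopRep, ((𝓛).level ⊥ r), σ⟧
            (comm r)) (Φ r (𝐫⟦red, T', ((𝓛).level ⊥ r)⟧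
              (c ⊥ ⟨r, fun _ hq => hPr (hr (Finset.mem_coe.2 hq))⟩)))) ∧
      (∀ (r : Finset (HeightOneSpectrum (𝓞 ℚ))) (hr : (↑r : Set _) ⊆ D''.primes),
        resSubgroup (W.torsionGaloisModule ((p : ℤ) ^ m * (p : ℤ))).toTopRep ((𝓛).level ⊥ r) 1 (κ'' r) =
          (r.noncommProd 𝐃⟦ℤ, (W.torsionGaloisModule ((p : ℤ) ^ m * (p : ℤ))).toTopRep, ((𝓛).level ⊥ r), σ⟧
            (comm'' r)) (Φ'' r (𝐫⟦red'', T'', ((𝓛).level ⊥ r)⟧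
              (c ⊥ ⟨r, fun _ hq => hPr'' (hr (Finset.mem_coe.2 hq))⟩)))) ∧
      ∀ d : Finset (HeightOneSpectrum (𝓞 ℚ)), (↑d : Set _) ⊆ D.primes → (↑d : Set _) ⊆ D''.primes →
        galoisCohomology.map π 1 (κ'' d) = κ d := by
  have hmk : (p : ℤ) ^ k * (p : ℤ) = ((p ^ (k + 1) : ℕ) : ℤ) := by push_cast; ring
  have hmm : (p : ℤ) ^ m * (p : ℤ) = ((p ^ (m + 1) : ℕ) : ℤ) := by push_cast; ring
  -- the pins in `tateToTorsion` form (T-DER-D4BN F1's `hcomp`)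
  have hcompk : ∀ a : W.tateModule p, tateToTorsion W p k a = e (red.hom a) := fun a =>
    Subtype.ext (by rw [coe_tateToTorsion_apply]; exact (hcomp a).symm)
  have hcompm : ∀ a : W.tateModule p, tateToTorsion W p m a = e'' (red''.hom a) := fun a =>
    Subtype.ext (by rw [coe_tateToTorsion_apply]; exact (hcomp'' a).symm)
  -- ONE generator family for both datums (D1 on `𝒫 ∪ 𝒫″`)
  obtain ⟨σ, hσI, hσχ, -, hσ⟩ := CyclotomicLevel.Rat.exists_sigma_mem_inertia_adicCompletionPrime p S η
    (D.primes ∪ D''.primes) (fun ℓ hℓ => hℓ.elim (fun h => hD.zpowers_eq_top h)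
      (fun h => hD''.zpowers_eq_top h))
  have hσk : ∀ r : Finset (HeightOneSpectrum (𝓞 ℚ)), (↑r : Set _) ⊆ D.primes → _ :=
    fun r hr => hσ r (hr.trans Set.subset_union_left)
  have hσm : ∀ r : Finset (HeightOneSpectrum (𝓞 ℚ)), (↑r : Set _) ⊆ D''.primes → _ :=
    fun r hr => hσ r (hr.trans Set.subset_union_right)
  -- `h0` at both depths from `Irr(E[p])`
  have h0k : ∀ r : Finset (HeightOneSpectrum (𝓞 ℚ)), (↑r : Set _) ⊆ D.primes →
      ∀ P : WeierstrassCurve.geomTorsion W ((p : ℤ) ^ k * (p : ℤ)),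
        (∀ u : (𝓛).level ⊥ r, (u : absoluteGaloisGroup ℚ) • P = P) → P = 0 :=
    fun r _ P hP => geomTorsion_eq_zero_of_fixed_level W p S hp2 hirr hmk ⊥ r P hP
  have h0m : ∀ r : Finset (HeightOneSpectrum (𝓞 ℚ)), (↑r : Set _) ⊆ D''.primes →
      ∀ P : WeierstrassCurve.geomTorsion W ((p : ℤ) ^ m * (p : ℤ)),
        (∀ u : (𝓛).level ⊥ r, (u : absoluteGaloisGroup ℚ) • P = P) → P = 0 :=
    fun r _ P hP => geomTorsion_eq_zero_of_fixed_level W p S hp2 hirr hmm ⊥ r P hP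
  -- the two families (D2), same `σ`
  obtain ⟨Φ, comm, hΦ, κ, hκ0, hκ⟩ := exists_derivativeFamily W p S hc red (Nat.succ_pos k) hM e hec he
    einv hic h₁ h₂ D.primes hPr hKol σ hσk h0k
  obtain ⟨Φ'', comm'', hΦ'', κ'', hκ0'', hκ''⟩ := exists_derivativeFamily W p S hc red'' (Nat.succ_pos m)
    hM'' e'' hec'' he'' einv'' hic'' h₁'' h₂'' D''.primes hPr'' hKol'' σ hσm h0m
  -- the global transports (GZ-1), for the pull-back of the classes to `T′`, `T″`
  obtain ⟨Φ₀, hΦ₀⟩ := exists_addEquiv_oneCocycleClass T'.toTopRep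
    (W.torsionGaloisModule ((p : ℤ) ^ k * (p : ℤ))).toTopRep e hec he einv hic h₁ h₂
  obtain ⟨Φ₀'', hΦ₀''⟩ := exists_addEquiv_oneCocycleClass T''.toTopRep
    (W.torsionGaloisModule ((p : ℤ) ^ m * (p : ℤ))).toTopRep e'' hec'' he'' einv'' hic'' h₁'' h₂''
  -- the unramified clause for `𝓕_can` at both depths (as in D4)
  have hunr : ∀ (j : ℕ) (w : HeightOneSpectrum (𝓞 ℚ)), W.HasGoodReductionAt w →
      ((primesEquiv w : Nat.Primes) : ℕ) ≠ p →
        unramifiedSubgroup (GaloisRep.toLocal w (W.torsionGaloisModule ((p : ℤ) ^ j * (p : ℤ)))) 1 ≤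
          propagatedSelmerStructure W p j (Sum.inr w) := fun j w hw hne =>
    (propagatedSelmerStructure_inr_eq_unramifiedSubgroup W p j
      (WeierstrassCurve.natCast_not_mem_asIdeal_of_primesEquiv_ne Fact.out hne) hw).ge
  -- an anomalous bad place, read off the failure of the torsion certificate
  have hanom : ∀ w : HeightOneSpectrum (𝓞 ℚ),
      ¬ (∀ P : (W.baseChange (w.adicCompletion ℚ)).toAffine.Point, p • P = 0 → P = 0) →
        ∃ P : (W.baseChange (w.adicCompletion ℚ)).toAffine.Point, p • P = 0 ∧ P ≠ 0 := by
    intro w htors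
    by_contra hcon
    exact htors fun P hP => by
      by_contra hP0
      exact hcon ⟨P, hP, hP0⟩
  refine ⟨σ, Φ, comm, κ, Φ'', comm'', κ'', hσI, hσχ, hΦ, hΦ'', ?_, ?_, hκ0, hκ0'',
    fun r hr => (hκ r hr).1, fun r hr => (hκ'' r hr).1, fun d hdk hdm => ?_⟩
  · -- depth `k`: THEOREM D-core (D3b); the non-good places by the three-way split
    refine isKolyvaginSystem_derivativeFamily_of_transverse_eq W p S hp2 hc red hred (Nat.succ_pos k) hM
      hmk e hec he einv hic h₁ h₂ D hT hD hPr hKol σ (fun ℓ _ => hσI ℓ) (fun ℓ _ => hσχ ℓ) hσk h0k Φ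
      hΦ comm κ hκ0 (fun r hr => (hκ r hr).1) _ (hunr k) fun d hd w hwd hw => ?_
    by_cases hwp : ((primesEquiv w : Nat.Primes) : ℕ) = p
    · rw [htop w hwp]
      exact AddSubgroup.mem_top _
    have hbad : ¬ W.HasGoodReductionAt w := fun hgood => hw ⟨hgood, hwp⟩
    by_cases htors : ∀ P : (W.baseChange (w.adicCompletion ℚ)).toAffine.Point, p • P = 0 → P = 0
    · rw [propagatedSelmerStructure_inr_eq_top_of_torsion_eq_zero W p k
        (WeierstrassCurve.natCast_not_mem_asIdeal_of_primesEquiv_ne Fact.out hwp) htors]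
      exact AddSubgroup.mem_top _
    · have hordq : ∀ q ∈ d, ¬ p ∣ orderOf ((((primesEquiv w : Nat.Primes) : ℕ) :
          ZMod ((primesEquiv q : Nat.Primes) : ℕ))) :=
        fun q hq => hP'' q (hd (Finset.mem_coe.2 hq)) w hbad hwp (hanom w htors)
      have hwd' : ∀ q ∈ d, q ≠ w := fun q hq hqw => hwd (hqw ▸ hq)
      have hκX := resSubgroup_symm_eq_noncommProd_deriv T'.toTopRep
        (W.torsionGaloisModule ((p : ℤ) ^ k * (p : ℤ))).toTopRep e hec he einv h₁ h₂ ((𝓛).level ⊥ d)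
        Φ₀ hΦ₀ (Φ d) (hΦ d) σ _ d
        (pairwise_commute_deriv (L := 𝓛) (T' := T') ⊥ d σ
          (fun ℓ => ((primesEquiv ℓ : Nat.Primes) : ℕ) - 1)) (comm d) _ (κ d) ((hκ d hd).1)
      rw [← Φ₀.apply_symm_apply (κ d)]
      exact Rat.localization_mem_propagatedSelmerStructure_of_res_eq_deriv_of_forall_not_dvd_orderOf W p k
        red e hec (fun g x => he g x) hcompk Φ₀.toAddMonoidHom (fun φ ψ h => hΦ₀ φ ψ h)
        ⟨d, fun _ hq => hPr (hd (Finset.mem_coe.2 hq))⟩ σ _ _ (Φ₀.symm (κ d)) hκX w hwd' hordq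
  · -- depth `m`: the same
    refine isKolyvaginSystem_derivativeFamily_of_transverse_eq W p S hp2 hc red'' hred'' (Nat.succ_pos m)
      hM'' hmm e'' hec'' he'' einv'' hic'' h₁'' h₂'' D'' hT'' hD'' hPr'' hKol'' σ (fun ℓ _ => hσI ℓ)
      (fun ℓ _ => hσχ ℓ) hσm h0m Φ'' hΦ'' comm'' κ'' hκ0'' (fun r hr => (hκ'' r hr).1) _ (hunr m)
      fun d hd w hwd hw => ?_
    by_cases hwp : ((primesEquiv w : Nat.Primes) : ℕ) = p
    · rw [htop'' w hwp]
      exact AddSubgroup.mem_top _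
    have hbad : ¬ W.HasGoodReductionAt w := fun hgood => hw ⟨hgood, hwp⟩
    by_cases htors : ∀ P : (W.baseChange (w.adicCompletion ℚ)).toAffine.Point, p • P = 0 → P = 0
    · rw [propagatedSelmerStructure_inr_eq_top_of_torsion_eq_zero W p m
        (WeierstrassCurve.natCast_not_mem_asIdeal_of_primesEquiv_ne Fact.out hwp) htors]
      exact AddSubgroup.mem_top _
    · have hordq : ∀ q ∈ d, ¬ p ∣ orderOf ((((primesEquiv w : Nat.Primes) : ℕ) :
          ZMod ((primesEquiv q : Nat.Primes) : ℕ))) :=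
        fun q hq => hP''₂ q (hd (Finset.mem_coe.2 hq)) w hbad hwp (hanom w htors)
      have hwd' : ∀ q ∈ d, q ≠ w := fun q hq hqw => hwd (hqw ▸ hq)
      have hκX := resSubgroup_symm_eq_noncommProd_deriv T''.toTopRep
        (W.torsionGaloisModule ((p : ℤ) ^ m * (p : ℤ))).toTopRep e'' hec'' he'' einv'' h₁'' h₂''
        ((𝓛).level ⊥ d) Φ₀'' hΦ₀'' (Φ'' d) (hΦ'' d) σ _ d
        (pairwise_commute_deriv (L := 𝓛) (T' := T'') ⊥ d σ
          (fun ℓ => ((primesEquiv ℓ : Nat.Primes) : ℕ) - 1)) (comm'' d) _ (κ'' d) ((hκ'' d hd).1)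
      rw [← Φ₀''.apply_symm_apply (κ'' d)]
      exact Rat.localization_mem_propagatedSelmerStructure_of_res_eq_deriv_of_forall_not_dvd_orderOf W p m
        red'' e'' hec'' (fun g x => he'' g x) hcompm Φ₀''.toAddMonoidHom (fun φ ψ h => hΦ₀'' φ ψ h)
        ⟨d, fun _ hq => hPr'' (hd (Finset.mem_coe.2 hq))⟩ σ _ _ (Φ₀''.symm (κ'' d)) hκX w hwd' hordq
  · -- (COMP) on the common levels
    exact map_derivativeFamily_eq W p S hkm red e hcomp red'' e'' hcomp'' π hπ (D.primes ∩ D''.primes)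
      (fun ℓ hℓ => hPr hℓ.1) σ Φ hΦ comm κ (fun r hr => hκ r (hr.trans Set.inter_subset_left)) Φ'' hΦ''
      comm'' κ'' (fun r hr => (hκ'' r (hr.trans Set.inter_subset_right)).1) d
      (Set.subset_inter hdk hdm)

end Summit.BirchSwinnertonDyer.Rank1Residual.GaloisImage.Derivative.Rat

end
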